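import Mathlib
import Summits.NavierStokesRegularity.NavierStokesRegularity.Theorems.EulerZoomLiouvillePowerGaugeEulerLiouvilleSelfSimilarPastProfileDissipation
import Summits.NavierStokesRegularity.NavierStokesRegularity.Theorems.EulerZoomLiouvillePowerGaugeEulerLiouvilleSelfSimilarPastProfilePressure
import HarnessLib

/-!
# The `E`- and `D`-gauges in profile variables at a NON-POSITIVE RATE for a PAST-EXACT self-similar member
# (crux `EulerZoomLiouville.PowerGaugeEulerLiouville` = stmt-NavierStokesRegularity-19832; line `logtime-breathers`, residue T4 `stub_powerClockRest`)

Route `EulerZoomLiouville` (NavierStokesRegularity); extra-width seat ns-ezl-w7 (cell ns-regularity-ideate, LEAD ns-typeII-p2 g11).  Large-scale profile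
data for «WEAK NEGATIVE-RATE power clocks are trivial» (sequel `…SelfSimilarNegClockPast`): the two bricks that convert the member`s `E`- and `D`-gauges
into the CLASS-`ρ` growth bounds (E₁) `∫_{B_L}|G|²_F ≲ L^{1−ρ}` and (D₁) `∫_{B_L}|P|^{3/2} ≲ L^{2−2ρ}` of the profile of a collapse
`u(τ,x) = (T−τ)^{g−1}W((T−τ)^{−g}(x−x₀))`, `p` likewise, valid for `τ < T₁` only (`T₁ ≤ 0`, `T₁ ≤ T`), at a rate `g ≤ 0`.  They are the `g ≤ 0`
twins of ns-ezl-w6's rate bricks (`SlowClock.profile_gradient_growth_of_gaugeE_past_rate` / `…pressure_growth_of_gaugeD_past_rate`, `0 ≤ g`,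
file `…SelfSimilarSlowClockPastGrowth`), whose window argument on `(T₁−2, T₁−1) × B_a` is repeated verbatim; the only change is the direction of
monotonicity of the profile scale: for `g ≤ 0`, `(T−τ)^g ≤ 1` once `T − τ ≥ 1`, so the radius `a = L + ‖x₀‖` serves every slice of the window.

* `NegClock.profile_gradient_growth_of_gaugeE_past_negRate` — the `E`-gauge at rate `g ≤ 0`;
* `NegClock.profile_pressure_growth_of_gaugeD_past_negRate` — the `D`-gauge at rate `g ≤ 0`.

WHAT THIS IS NOT: not NS, not E — helper lemmas for a stratum of the crux CLASS 19832 on the MODEL lattice, `--supports` stmt-19832. [folklore]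
-/

noncomputable section

-- flat `Theorems/<Route><Decl>…` files of one crux share the namespace of the crux (tree convention: `Summit.<S>.<S>.…`)
set_option linter.dupNamespace false

open MeasureTheory Set Filter Topology Metric Function TopologicalSpace
open scoped ENNReal NNReal

namespace Summit.NavierStokesRegularity.NavierStokesRegularity.Theorems.PowerGaugeEulerLiouville

open Literature.Analysis Literature.Analysis.FunctionSpaces Literature.Analysis.FluidPDE

namespace NegClock

/-! ### The `E`-gauge at a non-positive rate -/

/-- **THE `E`-GAUGE OF A PAST-EXACT MEMBER OF ANY RATE IN PROFILE VARIABLES (large scales).**  Let `H` be a.e.-strongly measurable on the slab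
`(−∞,0) × ℝ³` with `H(τ) = (T − τ)^{−1} • G((T − τ)^{−g}(· − x₀))` a.e. on `ℝ³` for a.e. `τ < T₁` (`T₁ ≤ 0`, `T₁ ≤ T`, `g ≤ 0`, `ρ < 1`), and
suppose `a^{ρ} E(a; 0; H) ≤ c` for all `a > 0`.  Then for some `C < ∞`: `∫_{B_L} |G|²_F ≤ C L^{1−ρ}` for every `L ≥ 2 − T₁`
(`C = S^{2−3g}(1 + ‖x₀‖)^{1−ρ} c`, `S = T − T₁ + 2`; for `g ≤ 0` the profile scale `(T−τ)^g ≤ 1` on the window `T − τ ≥ 1`).  The `g ≤ 0` twin of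
ns-ezl-w6's `SlowClock.profile_gradient_growth_of_gaugeE_past_rate` (`0 ≤ g ≤ 2/3`). [folklore] -/
-- adapted from …SelfSimilarSlowClockPastGrowth (ns-ezl-w6) ← …SelfSimilarPastProfileDissipation (ns-ezl-w1)
theorem profile_gradient_growth_of_gaugeE_past_negRate {ρ g : ℝ} (hρ1 : ρ < 1) (hg : g ≤ 0)
    {T T₁ : ℝ} (hT₁ : T₁ ≤ 0) (hTT₁ : T₁ ≤ T) (x₀ : EuclideanSpace ℝ (Fin 3))
    {H : ℝ → EuclideanSpace ℝ (Fin 3) → EuclideanSpace ℝ (Fin 3) →L[ℝ] EuclideanSpace ℝ (Fin 3)}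
    {G : EuclideanSpace ℝ (Fin 3) → EuclideanSpace ℝ (Fin 3) →L[ℝ] EuclideanSpace ℝ (Fin 3)} {c : ℝ≥0}
    (hHm : AEStronglyMeasurable (uncurry H)
      (volume.restrict (Iio (0 : ℝ) ×ˢ (univ : Set (EuclideanSpace ℝ (Fin 3))))))
    (hH : ∀ᵐ τ ∂((volume : Measure ℝ).restrict (Iio T₁)),
      H τ =ᵐ[volume] fun x => (T - τ) ^ (-1 : ℝ) • G ((T - τ) ^ (-g) • (x - x₀)))
    (hE : ∀ a : ℝ, 0 < a →
      ENNReal.ofReal (a ^ ρ) * cknE a (0 : ℝ × EuclideanSpace ℝ (Fin 3)) H ≤ (c : ℝ≥0∞)) :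
    ∃ C : ℝ≥0∞, C ≠ ⊤ ∧ ∀ L : ℝ, 2 - T₁ ≤ L →
      ∫⁻ y in ball (0 : EuclideanSpace ℝ (Fin 3)) L, ENNReal.ofReal (frobeniusNormSq (G y)) ≤
        C * ENNReal.ofReal (L ^ (1 - ρ)) := by
  have hg23 : 3 * g - 2 ≤ 0 := by linarith
  have h1ρ : 0 ≤ 1 - ρ := by linarith
  have hfm : Measurable fun L : EuclideanSpace ℝ (Fin 3) →L[ℝ] EuclideanSpace ℝ (Fin 3) =>
      ENNReal.ofReal (frobeniusNormSq L) :=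
    (SereginZajaczkowski2007.continuous_frobeniusNormSq).measurable.ennreal_ofReal
  -- the time scale `S = T − T₁ + 2` of the window `(T₁ − 2, T₁ − 1)` and the constant
  set S : ℝ := T - T₁ + 2 with hS
  have hS2 : 2 ≤ S := by rw [hS]; linarith
  have hS0 : 0 < S := by linarith
  set k : ℝ := S ^ (2 - 3 * g) * (1 + ‖x₀‖) ^ (1 - ρ) with hk
  refine ⟨ENNReal.ofReal k * (c : ℝ≥0∞), ENNReal.mul_ne_top ENNReal.ofReal_ne_top ENNReal.coe_ne_top,
    fun L hL => ?_⟩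
  have hL2 : 2 ≤ L := by linarith
  have hL0 : 0 < L := by linarith
  -- ### the radius `a = L + ‖x₀‖` (for `g ≤ 0` the profile scale `(T−τ)^g ≤ 1` on the window)
  set a : ℝ := L + ‖x₀‖ with ha
  have haL : L ≤ a := by
    have := norm_nonneg x₀
    rw [ha]; linarith
  have ha0 : 0 < a := by linarith
  have ha2 : 2 - T₁ ≤ a ^ 2 := by nlinarith
  -- ### (1) the gauge: `X = ∫∫_{Q_a} |H|²_F ≤ a^{1−ρ} c`
  set X : ℝ≥0∞ := ∫⁻ q in parabolicCylinder a (0 : ℝ × EuclideanSpace ℝ (Fin 3)),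
    ENNReal.ofReal (frobeniusNormSq (H q.1 q.2)) with hX
  have hXle : X ≤ ENNReal.ofReal (a ^ (1 - ρ)) * (c : ℝ≥0∞) := by
    have h1 := hE a ha0
    unfold cknE at h1
    have hB0 : ENNReal.ofReal (a ^ ρ) ≠ 0 := by
      rw [ENNReal.ofReal_ne_zero_iff]; exact Real.rpow_pos_of_pos ha0 _
    have hA0 : ENNReal.ofReal a ≠ 0 := by rw [ENNReal.ofReal_ne_zero_iff]; exact ha0
    have key : X = ENNReal.ofReal a * (ENNReal.ofReal (a ^ ρ))⁻¹ *
        (ENNReal.ofReal (a ^ ρ) * ((ENNReal.ofReal a)⁻¹ * X)) := by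
      rw [← mul_assoc, mul_assoc (ENNReal.ofReal a), ENNReal.inv_mul_cancel hB0 ENNReal.ofReal_ne_top,
        mul_one, ← mul_assoc, ENNReal.mul_inv_cancel hA0 ENNReal.ofReal_ne_top, one_mul]
    calc X = _ := key
      _ ≤ ENNReal.ofReal a * (ENNReal.ofReal (a ^ ρ))⁻¹ * (c : ℝ≥0∞) := by gcongr
      _ = ENNReal.ofReal (a ^ (1 - ρ)) * (c : ℝ≥0∞) := by
          rw [← ENNReal.ofReal_inv_of_pos (Real.rpow_pos_of_pos ha0 _), ← ENNReal.ofReal_mul ha0.le]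
          congr 2
          rw [Real.rpow_sub ha0, Real.rpow_one, div_eq_mul_inv]
  -- ### (2) the window `(T₁ − 2, T₁ − 1) × B_a` inside `Q_a(0,0)`
  have hWsub : Ioo (T₁ - 2) (T₁ - 1) ×ˢ ball (0 : EuclideanSpace ℝ (Fin 3)) a ⊆
      parabolicCylinder a (0 : ℝ × EuclideanSpace ℝ (Fin 3)) := by
    intro q hq
    rw [mem_prod, mem_Ioo, mem_ball] at hq
    rw [mem_parabolicCylinder, Prod.fst_zero, Prod.snd_zero, zero_sub]
    exact ⟨⟨by linarith [hq.1.1], by linarith [hq.1.2]⟩, hq.2⟩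
  have hY : ∫⁻ q in Ioo (T₁ - 2) (T₁ - 1) ×ˢ ball (0 : EuclideanSpace ℝ (Fin 3)) a,
      ENNReal.ofReal (frobeniusNormSq (H q.1 q.2)) ≤ X :=
    lintegral_mono_set hWsub
  -- ### (3) Tonelli on the window
  have hHmW : AEMeasurable (fun q : ℝ × EuclideanSpace ℝ (Fin 3) =>
      ENNReal.ofReal (frobeniusNormSq (H q.1 q.2)))
      (((volume : Measure ℝ).restrict (Ioo (T₁ - 2) (T₁ - 1))).prod
        ((volume : Measure (EuclideanSpace ℝ (Fin 3))).restrict (ball 0 a))) := by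
    have hsub : Ioo (T₁ - 2) (T₁ - 1) ×ˢ ball (0 : EuclideanSpace ℝ (Fin 3)) a ⊆
        Iio (0 : ℝ) ×ˢ (univ : Set (EuclideanSpace ℝ (Fin 3))) :=
      prod_mono (fun t ht => by have := ht.2; rw [mem_Iio]; linarith) (subset_univ _)
    have := hfm.comp_aemeasurable (hHm.mono_measure (Measure.restrict_mono hsub le_rfl)).aemeasurable
    rwa [Measure.volume_eq_prod, ← Measure.prod_restrict] at this
  have hYeq : ∫⁻ q in Ioo (T₁ - 2) (T₁ - 1) ×ˢ ball (0 : EuclideanSpace ℝ (Fin 3)) a,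
        ENNReal.ofReal (frobeniusNormSq (H q.1 q.2)) =
      ∫⁻ τ in Ioo (T₁ - 2) (T₁ - 1), ∫⁻ x in ball (0 : EuclideanSpace ℝ (Fin 3)) a,
        ENNReal.ofReal (frobeniusNormSq (H τ x)) := by
    rw [Measure.volume_eq_prod, ← Measure.prod_restrict, lintegral_prod _ hHmW]
  -- ### (4) the a.e. lower bound on the slices of the window
  set J : ℝ≥0∞ := ∫⁻ y in ball (0 : EuclideanSpace ℝ (Fin 3)) L, ENNReal.ofReal (frobeniusNormSq (G y)) with hJ
  have hWT : Ioo (T₁ - 2) (T₁ - 1) ⊆ Iio T₁ := fun t ht => by have := ht.2; rw [mem_Iio]; linarith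
  have hlow : ∀ᵐ τ ∂((volume : Measure ℝ).restrict (Ioo (T₁ - 2) (T₁ - 1))),
      ENNReal.ofReal (S ^ (3 * g - 2)) * J ≤
        ∫⁻ x in ball (0 : EuclideanSpace ℝ (Fin 3)) a, ENNReal.ofReal (frobeniusNormSq (H τ x)) := by
    filter_upwards [ae_restrict_of_ae_restrict_of_subset hWT hH, ae_restrict_mem measurableSet_Ioo]
      with τ hτ hτW
    have hs : 0 < T - τ := by have := hτW.2; linarith
    have hsS : T - τ ≤ S := by have := hτW.1; rw [hS]; linarith
    -- replace `H τ` by the self-similar gradient on the ball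
    have hcongr : ∫⁻ x in ball (0 : EuclideanSpace ℝ (Fin 3)) a, ENNReal.ofReal (frobeniusNormSq (H τ x)) =
        ∫⁻ x in ball (0 : EuclideanSpace ℝ (Fin 3)) a, ENNReal.ofReal (frobeniusNormSq
          ((T - τ) ^ (-1 : ℝ) • G ((T - τ) ^ (-g) • (x - x₀)))) :=
      lintegral_congr_ae (ae_restrict_of_ae (hτ.mono fun x hx => by simp only [hx]))
    rw [hcongr]
    have hLa : (T - τ) ^ g * L + ‖x₀‖ ≤ a := by
      have hs1 : 1 ≤ T - τ := by have := hτW.2; linarith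
      have : (T - τ) ^ g ≤ 1 := Real.rpow_le_one_of_one_le_of_nonpos hs1 hg
      rw [ha]; nlinarith
    calc ENNReal.ofReal (S ^ (3 * g - 2)) * J ≤ ENNReal.ofReal ((T - τ) ^ (3 * g - 2)) * J :=
          mul_le_mul' (ENNReal.ofReal_le_ofReal (Real.rpow_le_rpow_of_nonpos hs hsS hg23)) le_rfl
      _ ≤ _ := Past.lintegral_ball_frobeniusNormSq_shiftedGradient_ge g hs x₀ G hLa
  -- ### (5) integrate the lower bound over the window (length `1`)
  have hvolW : volume (Ioo (T₁ - 2) (T₁ - 1)) = 1 := by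
    rw [Real.volume_Ioo, show T₁ - 1 - (T₁ - 2) = (1 : ℝ) by ring, ENNReal.ofReal_one]
  have hJle : ENNReal.ofReal (S ^ (3 * g - 2)) * J ≤ X :=
    calc ENNReal.ofReal (S ^ (3 * g - 2)) * J
        = ∫⁻ _ in Ioo (T₁ - 2) (T₁ - 1), ENNReal.ofReal (S ^ (3 * g - 2)) * J := by
          rw [setLIntegral_const, hvolW, mul_one]
      _ ≤ ∫⁻ τ in Ioo (T₁ - 2) (T₁ - 1), ∫⁻ x in ball (0 : EuclideanSpace ℝ (Fin 3)) a,
            ENNReal.ofReal (frobeniusNormSq (H τ x)) := lintegral_mono_ae hlow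
      _ = _ := hYeq.symm
      _ ≤ X := hY
  -- ### (6) assemble
  have haL' : a ^ (1 - ρ) ≤ (1 + ‖x₀‖) ^ (1 - ρ) * L ^ (1 - ρ) := by
    rw [← Real.mul_rpow (by positivity) hL0.le]
    refine Real.rpow_le_rpow ha0.le ?_ h1ρ
    have : ‖x₀‖ ≤ ‖x₀‖ * L := le_mul_of_one_le_right (norm_nonneg _) (by linarith)
    rw [ha]; nlinarith
  have hunit : ENNReal.ofReal (S ^ (2 - 3 * g)) * ENNReal.ofReal (S ^ (3 * g - 2)) = 1 := by
    rw [← ENNReal.ofReal_mul (Real.rpow_nonneg hS0.le _), ← Real.rpow_add hS0,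
      show (2 - 3 * g) + (3 * g - 2) = 0 by ring, Real.rpow_zero, ENNReal.ofReal_one]
  calc J = ENNReal.ofReal (S ^ (2 - 3 * g)) * (ENNReal.ofReal (S ^ (3 * g - 2)) * J) := by
        rw [← mul_assoc, hunit, one_mul]
    _ ≤ ENNReal.ofReal (S ^ (2 - 3 * g)) * X := by gcongr
    _ ≤ ENNReal.ofReal (S ^ (2 - 3 * g)) * (ENNReal.ofReal (a ^ (1 - ρ)) * (c : ℝ≥0∞)) := by gcongr
    _ ≤ ENNReal.ofReal (S ^ (2 - 3 * g)) *
          (ENNReal.ofReal ((1 + ‖x₀‖) ^ (1 - ρ) * L ^ (1 - ρ)) * (c : ℝ≥0∞)) := by gcongr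
    _ = ENNReal.ofReal k * (c : ℝ≥0∞) * ENNReal.ofReal (L ^ (1 - ρ)) := by
        rw [hk, ENNReal.ofReal_mul (by positivity), ENNReal.ofReal_mul (by positivity)]
        ring

/-! ### The `D`-gauge at a non-positive rate -/

/-- **THE `D`-GAUGE OF A PAST-EXACT MEMBER OF ANY RATE IN PROFILE VARIABLES (large scales).**  Let `p` be a.e.-strongly measurable on the slab
`(−∞,0) × ℝ³` with `p(τ, x) = (T − τ)^{2(g−1)} P((T − τ)^{−g}(x − x₀))` for `τ < T₁` (`T₁ ≤ 0`, `T₁ ≤ T`, `g ≤ 0`, `ρ < 1`), and suppose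
`a^{2ρ} D(a; 0; p) ≤ c` for all `a > 0`.  Then for some `C < ∞`: `∫_{B_L} |P|^{3/2} ≤ C L^{2−2ρ}` for every `L ≥ 2 − T₁`
(`C = S^{3−6g}(1 + ‖x₀‖)^{2−2ρ} c`).  The `g ≤ 0` twin of ns-ezl-w6's `SlowClock.profile_pressure_growth_of_gaugeD_past_rate` (`0 ≤ g ≤ ½`). [folklore] -/
-- adapted from …SelfSimilarSlowClockPastGrowth (ns-ezl-w6) ← …SelfSimilarPastProfilePressure (ns-ezl-w1)
theorem profile_pressure_growth_of_gaugeD_past_negRate {ρ g : ℝ} (hρ1 : ρ < 1) (hg : g ≤ 0)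
    {T T₁ : ℝ} (hT₁ : T₁ ≤ 0) (hTT₁ : T₁ ≤ T) (x₀ : EuclideanSpace ℝ (Fin 3))
    {p : ℝ → EuclideanSpace ℝ (Fin 3) → ℝ} {P : EuclideanSpace ℝ (Fin 3) → ℝ} {c : ℝ≥0}
    (hpm : AEStronglyMeasurable (uncurry p)
      (volume.restrict (Iio (0 : ℝ) ×ˢ (univ : Set (EuclideanSpace ℝ (Fin 3))))))
    (hp : ∀ τ : ℝ, τ < T₁ → p τ = fun x => selfSimilarCollapsePressure g T P τ (x - x₀))
    (hD : ∀ a : ℝ, 0 < a →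
      ENNReal.ofReal (a ^ (2 * ρ)) * cknD a (0 : ℝ × EuclideanSpace ℝ (Fin 3)) p ≤ (c : ℝ≥0∞)) :
    ∃ C : ℝ≥0∞, C ≠ ⊤ ∧ ∀ L : ℝ, 2 - T₁ ≤ L →
      ∫⁻ y in ball (0 : EuclideanSpace ℝ (Fin 3)) L, ‖P y‖ₑ ^ (3 / 2 : ℝ) ≤
        C * ENNReal.ofReal (L ^ (2 - 2 * ρ)) := by
  have hg63 : 6 * g - 3 ≤ 0 := by linarith
  have h2ρ' : 0 ≤ 2 - 2 * ρ := by linarith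
  -- the time scale `S = T − T₁ + 2` of the window `(T₁ − 2, T₁ − 1)` and the constant
  set S : ℝ := T - T₁ + 2 with hS
  have hS2 : 2 ≤ S := by rw [hS]; linarith
  have hS0 : 0 < S := by linarith
  set k : ℝ := S ^ (3 - 6 * g) * (1 + ‖x₀‖) ^ (2 - 2 * ρ) with hk
  refine ⟨ENNReal.ofReal k * (c : ℝ≥0∞), ENNReal.mul_ne_top ENNReal.ofReal_ne_top ENNReal.coe_ne_top,
    fun L hL => ?_⟩
  have hL2 : 2 ≤ L := by linarith
  have hL0 : 0 < L := by linarith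
  -- ### the radius `a = L + ‖x₀‖` (for `g ≤ 0` the profile scale `(T−τ)^g ≤ 1` on the window)
  set a : ℝ := L + ‖x₀‖ with ha
  have haL : L ≤ a := by
    have := norm_nonneg x₀
    rw [ha]; linarith
  have ha0 : 0 < a := by linarith
  have ha2 : 2 - T₁ ≤ a ^ 2 := by nlinarith
  -- ### (1) the gauge: `X = ∫∫_{Q_a} |p|^{3/2} ≤ a^{2−2ρ} c`
  set X : ℝ≥0∞ := ∫⁻ q in parabolicCylinder a (0 : ℝ × EuclideanSpace ℝ (Fin 3)),
    ‖p q.1 q.2‖ₑ ^ (3 / 2 : ℝ) with hX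
  have hXle : X ≤ ENNReal.ofReal (a ^ (2 - 2 * ρ)) * (c : ℝ≥0∞) := by
    have h1 := hD a ha0
    unfold cknD at h1
    have hA0 : ENNReal.ofReal a ^ 2 ≠ 0 := pow_ne_zero _ (by rw [ENNReal.ofReal_ne_zero_iff]; exact ha0)
    have hAtop : ENNReal.ofReal a ^ 2 ≠ ⊤ := ENNReal.pow_ne_top ENNReal.ofReal_ne_top
    have hB0 : ENNReal.ofReal (a ^ (2 * ρ)) ≠ 0 := by
      rw [ENNReal.ofReal_ne_zero_iff]; exact Real.rpow_pos_of_pos ha0 _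
    have key : X = ENNReal.ofReal a ^ 2 * (ENNReal.ofReal (a ^ (2 * ρ)))⁻¹ *
        (ENNReal.ofReal (a ^ (2 * ρ)) * ((ENNReal.ofReal a ^ 2)⁻¹ * X)) := by
      rw [← mul_assoc, mul_assoc (ENNReal.ofReal a ^ 2), ENNReal.inv_mul_cancel hB0 ENNReal.ofReal_ne_top,
        mul_one, ← mul_assoc, ENNReal.mul_inv_cancel hA0 hAtop, one_mul]
    calc X = _ := key
      _ ≤ ENNReal.ofReal a ^ 2 * (ENNReal.ofReal (a ^ (2 * ρ)))⁻¹ * (c : ℝ≥0∞) := by gcongr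
      _ = ENNReal.ofReal (a ^ (2 - 2 * ρ)) * (c : ℝ≥0∞) := by
          rw [← ENNReal.ofReal_inv_of_pos (Real.rpow_pos_of_pos ha0 _), ← ENNReal.ofReal_pow ha0.le,
            ← ENNReal.ofReal_mul (by positivity)]
          congr 2
          rw [Real.rpow_sub ha0, Real.rpow_two, div_eq_mul_inv]
  -- ### (2) the window `(T₁ − 2, T₁ − 1) × B_a` inside `Q_a(0,0)`
  have hWsub : Ioo (T₁ - 2) (T₁ - 1) ×ˢ ball (0 : EuclideanSpace ℝ (Fin 3)) a ⊆
      parabolicCylinder a (0 : ℝ × EuclideanSpace ℝ (Fin 3)) := by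
    intro q hq
    rw [mem_prod, mem_Ioo, mem_ball] at hq
    rw [mem_parabolicCylinder, Prod.fst_zero, Prod.snd_zero, zero_sub]
    exact ⟨⟨by linarith [hq.1.1], by linarith [hq.1.2]⟩, hq.2⟩
  have hY : ∫⁻ q in Ioo (T₁ - 2) (T₁ - 1) ×ˢ ball (0 : EuclideanSpace ℝ (Fin 3)) a,
      ‖p q.1 q.2‖ₑ ^ (3 / 2 : ℝ) ≤ X :=
    lintegral_mono_set hWsub
  -- ### (3) Tonelli on the window
  have hpmW : AEMeasurable (fun q : ℝ × EuclideanSpace ℝ (Fin 3) => ‖p q.1 q.2‖ₑ ^ (3 / 2 : ℝ))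
      (((volume : Measure ℝ).restrict (Ioo (T₁ - 2) (T₁ - 1))).prod
        ((volume : Measure (EuclideanSpace ℝ (Fin 3))).restrict (ball 0 a))) := by
    have hsub : Ioo (T₁ - 2) (T₁ - 1) ×ˢ ball (0 : EuclideanSpace ℝ (Fin 3)) a ⊆
        Iio (0 : ℝ) ×ˢ (univ : Set (EuclideanSpace ℝ (Fin 3))) :=
      prod_mono (fun t ht => by have := ht.2; rw [mem_Iio]; linarith) (subset_univ _)
    have := (hpm.mono_measure (Measure.restrict_mono hsub le_rfl)).enorm.pow_const (3 / 2 : ℝ)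
    rwa [Measure.volume_eq_prod, ← Measure.prod_restrict] at this
  have hYeq : ∫⁻ q in Ioo (T₁ - 2) (T₁ - 1) ×ˢ ball (0 : EuclideanSpace ℝ (Fin 3)) a,
        ‖p q.1 q.2‖ₑ ^ (3 / 2 : ℝ) =
      ∫⁻ τ in Ioo (T₁ - 2) (T₁ - 1), ∫⁻ x in ball (0 : EuclideanSpace ℝ (Fin 3)) a,
        ‖p τ x‖ₑ ^ (3 / 2 : ℝ) := by
    rw [Measure.volume_eq_prod, ← Measure.prod_restrict, lintegral_prod _ hpmW]
  -- ### (4) the lower bound on the slices of the window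
  set J : ℝ≥0∞ := ∫⁻ y in ball (0 : EuclideanSpace ℝ (Fin 3)) L, ‖P y‖ₑ ^ (3 / 2 : ℝ) with hJ
  have hlow : ∀ᵐ τ ∂((volume : Measure ℝ).restrict (Ioo (T₁ - 2) (T₁ - 1))),
      ENNReal.ofReal (S ^ (6 * g - 3)) * J ≤
        ∫⁻ x in ball (0 : EuclideanSpace ℝ (Fin 3)) a, ‖p τ x‖ₑ ^ (3 / 2 : ℝ) := by
    filter_upwards [ae_restrict_mem measurableSet_Ioo] with τ hτW
    have hτ : τ < T₁ := by have := hτW.2; linarith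
    have hs : 0 < T - τ := by linarith
    have hsS : T - τ ≤ S := by have := hτW.1; rw [hS]; linarith
    have hpτ : (fun x => ‖p τ x‖ₑ ^ (3 / 2 : ℝ)) = fun x =>
        ‖(T - τ) ^ (2 * (g - 1)) * P ((T - τ) ^ (-g) • (x - x₀))‖ₑ ^ (3 / 2 : ℝ) := by
      funext x
      rw [hp τ hτ]
      simp only [selfSimilarCollapsePressure_apply]
    rw [hpτ]
    have hLa : (T - τ) ^ g * L + ‖x₀‖ ≤ a := by
      have hs1 : 1 ≤ T - τ := by have := hτW.2; linarith
      have : (T - τ) ^ g ≤ 1 := Real.rpow_le_one_of_one_le_of_nonpos hs1 hg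
      rw [ha]; nlinarith
    calc ENNReal.ofReal (S ^ (6 * g - 3)) * J ≤ ENNReal.ofReal ((T - τ) ^ (6 * g - 3)) * J :=
          mul_le_mul' (ENNReal.ofReal_le_ofReal (Real.rpow_le_rpow_of_nonpos hs hsS hg63)) le_rfl
      _ ≤ _ := Past.lintegral_ball_enorm_rpow_shiftedPressure_ge g hs x₀ P hLa
  -- ### (5) integrate the lower bound over the window (length `1`)
  have hvolW : volume (Ioo (T₁ - 2) (T₁ - 1)) = 1 := by
    rw [Real.volume_Ioo, show T₁ - 1 - (T₁ - 2) = (1 : ℝ) by ring, ENNReal.ofReal_one]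
  have hJle : ENNReal.ofReal (S ^ (6 * g - 3)) * J ≤ X :=
    calc ENNReal.ofReal (S ^ (6 * g - 3)) * J
        = ∫⁻ _ in Ioo (T₁ - 2) (T₁ - 1), ENNReal.ofReal (S ^ (6 * g - 3)) * J := by
          rw [setLIntegral_const, hvolW, mul_one]
      _ ≤ ∫⁻ τ in Ioo (T₁ - 2) (T₁ - 1), ∫⁻ x in ball (0 : EuclideanSpace ℝ (Fin 3)) a,
            ‖p τ x‖ₑ ^ (3 / 2 : ℝ) := lintegral_mono_ae hlow
      _ = _ := hYeq.symm
      _ ≤ X := hY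
  -- ### (6) assemble
  have haL' : a ^ (2 - 2 * ρ) ≤ (1 + ‖x₀‖) ^ (2 - 2 * ρ) * L ^ (2 - 2 * ρ) := by
    rw [← Real.mul_rpow (by positivity) hL0.le]
    refine Real.rpow_le_rpow ha0.le ?_ h2ρ'
    have : ‖x₀‖ ≤ ‖x₀‖ * L := le_mul_of_one_le_right (norm_nonneg _) (by linarith)
    rw [ha]; nlinarith
  have hunit : ENNReal.ofReal (S ^ (3 - 6 * g)) * ENNReal.ofReal (S ^ (6 * g - 3)) = 1 := by
    rw [← ENNReal.ofReal_mul (Real.rpow_nonneg hS0.le _), ← Real.rpow_add hS0,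
      show (3 - 6 * g) + (6 * g - 3) = 0 by ring, Real.rpow_zero, ENNReal.ofReal_one]
  calc J = ENNReal.ofReal (S ^ (3 - 6 * g)) * (ENNReal.ofReal (S ^ (6 * g - 3)) * J) := by
        rw [← mul_assoc, hunit, one_mul]
    _ ≤ ENNReal.ofReal (S ^ (3 - 6 * g)) * X := by gcongr
    _ ≤ ENNReal.ofReal (S ^ (3 - 6 * g)) * (ENNReal.ofReal (a ^ (2 - 2 * ρ)) * (c : ℝ≥0∞)) := by gcongr
    _ ≤ ENNReal.ofReal (S ^ (3 - 6 * g)) *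
          (ENNReal.ofReal ((1 + ‖x₀‖) ^ (2 - 2 * ρ) * L ^ (2 - 2 * ρ)) * (c : ℝ≥0∞)) := by gcongr
    _ = ENNReal.ofReal k * (c : ℝ≥0∞) * ENNReal.ofReal (L ^ (2 - 2 * ρ)) := by
        rw [hk, ENNReal.ofReal_mul (by positivity), ENNReal.ofReal_mul (by positivity)]
        ring

end NegClock

end Summit.NavierStokesRegularity.NavierStokesRegularity.Theorems.PowerGaugeEulerLiouville

end
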